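/-
Copyright: seat `ym-line-sll-p3` (prover-ym-line-sll-p3-g0-0), route `SoftLoopLongLag`, cruxes `SoftLoopLagFloorToTorus`
(stmt-QuantumFields-22504) / `ColdBoxSoftLoopLagFloor` (stmt-QuantumFields-22503, rev 2 = 23990), lines `birth`.
-/
import Summits.QuantumFields.YangMills.Theorems.SoftLoopLongLagColdBoxInnerMixturePlumbingG

/-!
# Route `SoftLoopLongLag` — the IN-BOX MIXTURE P_T (WAVE 3 P3-b), part 2 of 2: the cold-box soft-loop lag floor of the OUTER lag box
# from an inner DATUM floor and an inner DATUM mean smoothness in the cube geometry of `ColdBoxAllGroups`, for EVERY compact gauge group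

WHAT.  `coldBoxFloor_of_innerMixture` (T‴-shaped interface).  Parameters `ε b a κ c K` with `0 < ε`, `0 < κ`, `0 < c`, the window
`13ε + 2κ < 2b` and `b < a`; `R = ⌈β^ε⌉` (loop side), `n = ⌈β^a⌉` (outer lag box `Λ_n`), `H = ⌈β^b⌉` (inner cube
`Λ₀ = AxialGauge.boxEdges 4 (2H+1)`, kernel `boxKernelG r.ρ β H ζ`), `F_H = F_R ∘ configShift (−boxCentre H)`, inner hot event
`hot′ = (coldEvent r β (2κ) Λ₀)ᶜ` (threshold `β^{2κ−1}`).  INPUTS (hypotheses, `∃ β₀`-form):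
(E1) inner datum floor — for `β ≥ β₀` and every `ζ` with `CrudeGoodG r.ρ β (κ/2) H ζ` and `γ_{Λ₀}(hot′ | ζ) ≤ e^{−β^{κ/8}}`:
  `c·R³·β^{-2} ≤ lagCov (boxKernelG r.ρ β H ζ) F_H R`;
(E2) inner datum mean smoothness — same data: `|∫ F_H∘α_R dγ_{Λ₀}(·|ζ) − ∫ F_H dγ_{Λ₀}(·|ζ)| ≤ K·R⁸·β^{κ−1}/H`.
CONCLUSION: `∃ β₀, ∀ β ≥ β₀, ∀ η`, if every plaquette touching `Λ_n` costs `≤ β^{κ/2−1}` on `η` (not used) and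
`γ_{Λ_n}(coldᶜ | η) ≤ e^{−β^{κ/4}}` (cold = threshold `β^{κ−1}`), then `(c/8)·R³·β^{-2} ≤ lagCov (coldKernel r β κ n η) F_R R`.

PROOF (part 1 `…InnerMixturePlumbingG` supplies every named step).  `μ := γ_{Λ_n}(·|η)` is the mixture `∫ γ_{Λ'}(·|ζ) dμ(ζ)` over the centred
cube `Λ' = Λ₀ − boxCentre H ⊆ Λ_n` (DLR consistency in `ℤ⁴`, `integral_ymSpecification_consistent`); with `h, k, q` the `γ_{Λ'}(·|ζ)`-means of
`F_R`, `F_R∘α_R`, `F_R·F_R∘α_R` (= the cube-kernel means of `F_H`, … at `configShift (boxCentre H) ζ`, `integral_innerKernel_eq`) the abstract law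
of total covariance `total_covariance_lower_bound_sub` applies with the exceptional set `coldᶜ ∪ {ζ : γ_{Λ'}(hot″|ζ) > e^{−β^{κ/8}}}`
(`hot″` = shifted `hot′` ⊆ `coldᶜ`, `not_mem_coldEvent_of_innerHot`): its `μ`-mass is `≤ e^{−β^{κ/4}}(1 + e^{β^{κ/8}}) ≤ 2e^{−β^{κ/8}}` (Markov +
consistency, `measureReal_ymSpecification_consistent`), and off it the shifted datum is crude-good (`crudeGoodG_configShift_of_mem_coldEvent`) and
cold-typical, so (E1)/(E2) give `q − hk ≥ θ₀ = cR³β^{-2}` and `|k − h| ≤ |K|R⁸β^{κ−1}/H`; the window makes `(|K|R⁸β^{κ−1}/H)²/2 ≤ (c/16)·β^{3ε}β^{-2}`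
and every `e^{−β^{κ/8}}` term `≤ (c/8)·β^{3ε}β^{-2}` eventually; finally the conditioning on the outer cold event costs `≤ 5B²e^{−β^{κ/4}}`
(`cov_sub_measureReal_mul_condCov_le`): `Cov_ν ≥ θ₀ − 3θ₀/16 ≥ θ₀/8`.

HONEST LABEL: rung R2xi-G RECORD label (leaf `WeakCouplingRates.XiPow`, an UPPER bound on the lattice mass gap for every compact simple `G`);
NOT the Clay mass gap; no summit statement is touched.  No analysis: (E1), (E2) are hypotheses (the one-scale engine of `ColdBoxAllGroups`).

References: H.-O. Georgii, *Gibbs Measures and Phase Transitions* (2011) Def. 1.23 (iii), §5.1 (5.8); R. Durrett (2019) §4.1.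
-/

set_option autoImplicit false

noncomputable section

open MeasureTheory Filter Topology
open Literature.Probability.LatticeModels (Site box mem_box box_mono)
open Literature.MathematicalPhysics Literature.MathematicalPhysics.QuantumFieldTheory
open Literature.MathematicalPhysics.QuantumLattice
open Summit.QuantumFields.YangMills.Theorems.WeakCouplingRates
open Summit.QuantumFields.YangMills.Theorems.ColdBoxAllGroups (CrudeGoodG boxKernelG)

namespace Summit.QuantumFields.YangMills.Theorems.SoftLoopLongLag

/-- `rpow` bookkeeping for the inner mixture: `β^{5ε+2}·(β^{3ε}β^{-2}) = β^{8ε}`. [folklore] -/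
theorem rpow_mixture_identity {β ε : ℝ} (hβ : 0 < β) :
    β ^ (5 * ε + 2) * ((β ^ ε) ^ 3 * β ^ (-(2 : ℝ))) = (β ^ ε) ^ 8 := by
  rw [← Real.rpow_natCast (β ^ ε) 3, ← Real.rpow_natCast (β ^ ε) 8, ← Real.rpow_mul hβ.le, ← Real.rpow_mul hβ.le,
    ← Real.rpow_add hβ, ← Real.rpow_add hβ]
  congr 1
  push_cast
  ring

/-- **P_T — the cold-box soft-loop lag floor of the outer lag box from the inner datum floor (E1) and the inner datum mean smoothness (E2)**
(WAVE 3 P3-b; see the module docstring for the statement in words and the proof).  Every compact `G`; window `13ε + 2κ < 2b`, `b < a`.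
[folklore] -/
theorem coldBoxFloor_of_innerMixture :
    ∀ (G : Type) [Group G] [TopologicalSpace G] [IsTopologicalGroup G] [CompactSpace G] [MeasurableSpace G] [BorelSpace G]
      (r : LatticeRep G) (ε b a κ c K : ℝ), 0 < ε → 0 < κ → 0 < c → 13 * ε + 2 * κ < 2 * b → b < a →
      -- (E1) inner datum floor, cube geometry of `ColdBoxAllGroups`, observable translated to the cube centre
      (∃ β₀ : ℝ, ∀ β : ℝ, β₀ ≤ β → ∀ ζ : LGConfig 4 G, CrudeGoodG r.ρ β (κ / 2) ⌈β ^ b⌉₊ ζ →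
          boxKernelG r.ρ β ⌈β ^ b⌉₊ ζ (coldEvent r β (2 * κ) (AxialGauge.boxEdges 4 (2 * ⌈β ^ b⌉₊ + 1)))ᶜ ≤
            ENNReal.ofReal (Real.exp (-(β ^ (κ / 8)))) →
          c * (⌈β ^ ε⌉₊ : ℝ) ^ 3 * β ^ (-(2 : ℝ)) ≤
            lagCov (boxKernelG r.ρ β ⌈β ^ b⌉₊ ζ)
              (fun U => softLoopObs r ⌈β ^ ε⌉₊ (configShift (-(boxCentre ⌈β ^ b⌉₊)) U)) ⌈β ^ ε⌉₊) →
      -- (E2) inner datum mean smoothness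
      (∃ β₀ : ℝ, ∀ β : ℝ, β₀ ≤ β → ∀ ζ : LGConfig 4 G, CrudeGoodG r.ρ β (κ / 2) ⌈β ^ b⌉₊ ζ →
          boxKernelG r.ρ β ⌈β ^ b⌉₊ ζ (coldEvent r β (2 * κ) (AxialGauge.boxEdges 4 (2 * ⌈β ^ b⌉₊ + 1)))ᶜ ≤
            ENNReal.ofReal (Real.exp (-(β ^ (κ / 8)))) →
          |(∫ U, softLoopObs r ⌈β ^ ε⌉₊ (configShift (-(boxCentre ⌈β ^ b⌉₊)) (timeShiftLG (G := G) ⌈β ^ ε⌉₊ U))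
                ∂(boxKernelG r.ρ β ⌈β ^ b⌉₊ ζ)) -
              ∫ U, softLoopObs r ⌈β ^ ε⌉₊ (configShift (-(boxCentre ⌈β ^ b⌉₊)) U) ∂(boxKernelG r.ρ β ⌈β ^ b⌉₊ ζ)|
            ≤ K * (⌈β ^ ε⌉₊ : ℝ) ^ 8 * β ^ (κ - 1) / (⌈β ^ b⌉₊ : ℝ)) →
      ∃ β₀ : ℝ, ∀ β : ℝ, β₀ ≤ β → ∀ η : LGConfig 4 G,
        (∀ p ∈ plaquettesTouching (lagBox ⌈β ^ a⌉₊),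
          (r.N : ℝ) - plaquetteObs r.ρ p.1 p.2.1.1 p.2.1.2 η ≤ β ^ (κ / 2 - 1)) →
        ymSpecification (d := 4) r.ρ β (lagBox ⌈β ^ a⌉₊) η (coldEvent r β κ (lagBox ⌈β ^ a⌉₊))ᶜ ≤
          ENNReal.ofReal (Real.exp (-(β ^ (κ / 4)))) →
        c / 8 * (⌈β ^ ε⌉₊ : ℝ) ^ 3 * β ^ (-(2 : ℝ)) ≤
          lagCov (coldKernel r β κ ⌈β ^ a⌉₊ η) (softLoopObs r ⌈β ^ ε⌉₊) ⌈β ^ ε⌉₊ := by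
  intro G _ _ _ _ _ _ r ε b a κ c K hε hκ hc hwin hba hE1 hE2
  obtain ⟨β₁, hE1⟩ := hE1
  obtain ⟨β₂, hE2⟩ := hE2
  haveI : SecondCountableTopology G := r.secondCountableTopology
  have hb : 0 < b := by linarith
  have ha : 0 < a := hb.trans hba
  have hab : 0 < a - b := by linarith
  -- the window gap and the asymptotic thresholds
  set g : ℝ := 2 * b - 13 * ε - 4 * (κ / 2) with hg
  have hg0 : 0 < g := by rw [hg]; linarith
  have hT1 : ∀ᶠ β : ℝ in atTop, (4 : ℝ) ≤ β ^ (a - b) := (tendsto_rpow_atTop hab).eventually_ge_atTop 4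
  have hT2 : ∀ᶠ β : ℝ in atTop, 32768 * K ^ 2 * β ^ (-g) ≤ c / 16 := by
    have ht : Tendsto (fun β : ℝ => 32768 * K ^ 2 * β ^ (-g)) atTop (𝓝 (32768 * K ^ 2 * 0)) :=
      (tendsto_rpow_neg_atTop hg0).const_mul _
    rw [mul_zero] at ht
    exact ht.eventually (eventually_le_nhds (by positivity))
  set CJ : ℝ := 16 * c + 4296875 with hCJ
  have hCJ0 : 0 < CJ := by positivity
  have hT3 : ∀ᶠ β : ℝ in atTop, CJ * (β ^ (5 * ε + 2) * Real.exp (-(β ^ (κ / 8)))) ≤ c / 8 := by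
    have ht := (tendsto_rpow_mul_exp_neg_rpow (5 * ε + 2) (by positivity : 0 < κ / 8)).const_mul CJ
    rw [mul_zero] at ht
    exact ht.eventually (eventually_le_nhds (by positivity))
  have hT4 : ∀ᶠ β : ℝ in atTop, (2 : ℝ) ≤ β ^ (κ / 8) := (tendsto_rpow_atTop (by positivity : 0 < κ / 8)).eventually_ge_atTop 2
  obtain ⟨β₅, hβ₅⟩ := Filter.eventually_atTop.1 (hT1.and (hT2.and (hT3.and hT4)))
  refine ⟨max (max β₁ β₂) (max β₅ 2), fun β hβ η _hcg hcold => ?_⟩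
  simp only [max_le_iff] at hβ
  obtain ⟨⟨hb1, hb2⟩, hb5, hb7⟩ := hβ
  have hb6 : (1 : ℝ) ≤ β := by linarith
  have hβ0 : 0 < β := by linarith
  obtain ⟨hA1, hA2, hA3, hA4⟩ := hβ₅ β hb5
  obtain ⟨-, hid2⟩ := rpow_window_identities (ε := ε) (a := b) (δ := κ / 2) hβ0 hg
  have hidY := rpow_mixture_identity (ε := ε) hβ0
  set R : ℕ := ⌈β ^ ε⌉₊ with hR
  set n : ℕ := ⌈β ^ a⌉₊ with hn
  set H : ℕ := ⌈β ^ b⌉₊ with hH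
  simp only [lagCov, coldKernel]
  -- sizes
  have hu1 : 1 ≤ β ^ ε := Real.one_le_rpow hb6 hε.le
  have hu0 : 0 < β ^ ε := by positivity
  have hRge : β ^ ε ≤ (R : ℝ) := Nat.le_ceil _
  have hRle : (R : ℝ) ≤ 2 * β ^ ε := (one_le_ceil_rpow_and_le hb6 hε.le).2
  have hvb1 : 1 ≤ β ^ b := Real.one_le_rpow hb6 hb.le
  have hvb0 : 0 < β ^ b := by positivity
  have hHge : β ^ b ≤ (H : ℝ) := Nat.le_ceil _
  have hHle : (H : ℝ) ≤ 2 * β ^ b := (one_le_ceil_rpow_and_le hb6 hb.le).2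
  have hH0 : (0 : ℝ) < H := lt_of_lt_of_le hvb0 hHge
  have hnge : β ^ a ≤ (n : ℝ) := Nat.le_ceil _
  have hHn : H + 2 ≤ n := by
    have hsplit : β ^ a = β ^ (a - b) * β ^ b := by rw [← Real.rpow_add hβ0]; ring_nf
    have h4 : 4 * β ^ b ≤ β ^ a := by rw [hsplit]; exact mul_le_mul_of_nonneg_right hA1 hvb0.le
    have h1 : (H : ℝ) + 2 ≤ (n : ℝ) := by linarith
    exact_mod_cast h1
  have hβm2 : 0 < β ^ (-(2 : ℝ)) := Real.rpow_pos_of_pos hβ0 _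
  have hβm2' : β ^ (-(2 : ℝ)) ≤ 1 := Real.rpow_le_one_of_one_le_of_nonpos hb6 (by norm_num)
  set B : ℝ := (2 * (R : ℝ) + 1) ^ 4 with hB
  set θ₀ : ℝ := c * (R : ℝ) ^ 3 * β ^ (-(2 : ℝ)) with hθ₀
  set Y : ℝ := (β ^ ε) ^ 3 * β ^ (-(2 : ℝ)) with hY
  set e' : ℝ := Real.exp (-(β ^ (κ / 8))) with he'def
  set eo : ℝ := Real.exp (-(β ^ (κ / 4))) with heodef
  have he'0 : 0 < e' := Real.exp_pos _
  have heo0 : 0 < eo := Real.exp_pos _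
  have he'1 : e' ≤ 1 := by rw [he'def]; exact Real.exp_le_one_iff.2 (by simp [Real.rpow_nonneg hβ0.le])
  have hY0 : 0 < Y := by positivity
  have hθY : c * Y ≤ θ₀ := by
    rw [hθ₀, hY, ← mul_assoc]
    exact mul_le_mul_of_nonneg_right (mul_le_mul_of_nonneg_left (pow_le_pow_left₀ hu0.le hRge 3) hc.le) hβm2.le
  have hθ0 : 0 ≤ θ₀ := by positivity
  have hB0 : 0 ≤ B := by positivity
  have hBle : B ≤ 625 * (β ^ ε) ^ 4 := by
    have h5 : 2 * (R : ℝ) + 1 ≤ 5 * β ^ ε := by linarith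
    calc B = (2 * (R : ℝ) + 1) ^ 4 := hB
      _ ≤ (5 * β ^ ε) ^ 4 := pow_le_pow_left₀ (by positivity) h5 4
      _ = 625 * (β ^ ε) ^ 4 := by ring
  have hB2le : B ^ 2 ≤ 390625 * (β ^ ε) ^ 8 := by
    calc B ^ 2 ≤ (625 * (β ^ ε) ^ 4) ^ 2 := pow_le_pow_left₀ hB0 hBle 2
      _ = 390625 * (β ^ ε) ^ 8 := by ring
  have hθle : θ₀ ≤ 8 * c * (β ^ ε) ^ 8 := by
    have hR3 : (R : ℝ) ^ 3 ≤ (2 * β ^ ε) ^ 3 := pow_le_pow_left₀ (by positivity) hRle 3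
    have h38 : (β ^ ε) ^ 3 ≤ (β ^ ε) ^ 8 := pow_le_pow_right₀ hu1 (by norm_num)
    calc θ₀ = c * (R : ℝ) ^ 3 * β ^ (-(2 : ℝ)) := hθ₀
      _ ≤ c * (2 * β ^ ε) ^ 3 * 1 := mul_le_mul (mul_le_mul_of_nonneg_left hR3 hc.le) hβm2' hβm2.le (by positivity)
      _ = 8 * c * (β ^ ε) ^ 3 := by ring
      _ ≤ 8 * c * (β ^ ε) ^ 8 := mul_le_mul_of_nonneg_left h38 (by positivity)
  -- `eo ≤ eo / e' ≤ e'` (since `β^{κ/4} = (β^{κ/8})²` and `β^{κ/8} ≥ 2`)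
  have heoe' : eo / e' ≤ e' := by
    rw [div_le_iff₀ he'0, heodef, he'def, ← Real.exp_add]
    refine Real.exp_le_exp.2 ?_
    have hsq : β ^ (κ / 4) = β ^ (κ / 8) * β ^ (κ / 8) := by rw [← Real.rpow_add hβ0]; ring_nf
    have hu0 : 0 ≤ β ^ (κ / 8) := by positivity
    have h2u : 2 * β ^ (κ / 8) ≤ β ^ (κ / 8) * β ^ (κ / 8) := mul_le_mul_of_nonneg_right hA4 hu0
    linarith
  have heo_le : eo ≤ e' := by
    have h1 : eo ≤ eo / e' := by
      rw [le_div_iff₀ he'0]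
      exact mul_le_of_le_one_right heo0.le he'1
    exact h1.trans heoe'
  -- the junk terms
  set p : ℝ := eo + eo / e' with hp
  have hp0 : 0 ≤ p := by positivity
  have hp2 : p ≤ 2 * e' := by rw [hp]; linarith
  have hJ : (θ₀ + 3 * B ^ 2) * p + 5 * B ^ 2 * eo ≤ c / 8 * Y := by
    have h1 : (θ₀ + 3 * B ^ 2) * p + 5 * B ^ 2 * eo ≤ (2 * θ₀ + 11 * B ^ 2) * e' := by
      have := mul_le_mul_of_nonneg_left hp2 (by positivity : 0 ≤ θ₀ + 3 * B ^ 2)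
      have := mul_le_mul_of_nonneg_left heo_le (by positivity : 0 ≤ 5 * B ^ 2)
      linarith
    have h2 : 2 * θ₀ + 11 * B ^ 2 ≤ CJ * (β ^ ε) ^ 8 := by rw [hCJ]; linarith
    have h3 : CJ * (β ^ ε) ^ 8 * e' = CJ * (β ^ (5 * ε + 2) * e') * Y := by rw [← hidY]; ring
    calc (θ₀ + 3 * B ^ 2) * p + 5 * B ^ 2 * eo ≤ (2 * θ₀ + 11 * B ^ 2) * e' := h1
      _ ≤ CJ * (β ^ ε) ^ 8 * e' := mul_le_mul_of_nonneg_right h2 he'0.le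
      _ = CJ * (β ^ (5 * ε + 2) * e') * Y := h3
      _ ≤ c / 8 * Y := mul_le_mul_of_nonneg_right hA3 hY0.le
  set ε₀ : ℝ := |K| * (R : ℝ) ^ 8 * β ^ (κ - 1) / (H : ℝ) with hε₀
  have hε₀0 : 0 ≤ ε₀ := by positivity
  have hJ3 : ε₀ ^ 2 / 2 ≤ c / 16 * Y := by
    have hs : β ^ (κ - 1) = β ^ (2 * (κ / 2) - 1) := by congr 1; ring
    have hR8 : (R : ℝ) ^ 8 ≤ 256 * (β ^ ε) ^ 8 := by
      calc (R : ℝ) ^ 8 ≤ (2 * β ^ ε) ^ 8 := pow_le_pow_left₀ (by positivity) hRle 8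
        _ = 256 * (β ^ ε) ^ 8 := by ring
    have hε₀le : ε₀ ≤ 256 * |K| * ((β ^ ε) ^ 8 * β ^ (2 * (κ / 2) - 1) / β ^ b) := by
      rw [hε₀, hs]
      calc |K| * (R : ℝ) ^ 8 * β ^ (2 * (κ / 2) - 1) / (H : ℝ)
          ≤ |K| * (256 * (β ^ ε) ^ 8) * β ^ (2 * (κ / 2) - 1) / (H : ℝ) := by gcongr
        _ ≤ |K| * (256 * (β ^ ε) ^ 8) * β ^ (2 * (κ / 2) - 1) / β ^ b :=
            div_le_div_of_nonneg_left (by positivity) hvb0 hHge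
        _ = 256 * |K| * ((β ^ ε) ^ 8 * β ^ (2 * (κ / 2) - 1) / β ^ b) := by ring
    have hsq : ε₀ ^ 2 ≤ (256 * |K| * ((β ^ ε) ^ 8 * β ^ (2 * (κ / 2) - 1) / β ^ b)) ^ 2 := pow_le_pow_left₀ hε₀0 hε₀le 2
    rw [mul_pow, mul_pow, hid2, sq_abs] at hsq
    have h3 : ε₀ ^ 2 / 2 ≤ 32768 * K ^ 2 * β ^ (-g) * Y := by linarith
    exact h3.trans (mul_le_mul_of_nonneg_right hA2 hY0.le)
  -- the outer kernel and the inner cube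
  set Λ : Finset (QuantumLattice.ZdEdge 4) := lagBox n with hΛ
  set Λ₀ : Finset (QuantumLattice.ZdEdge 4) := AxialGauge.boxEdges 4 (2 * H + 1) with hΛ₀
  set bc : Site 4 := boxCentre H with hbc
  set Λ' : Finset (QuantumLattice.ZdEdge 4) := Λ₀.map (edgeShift (-bc)).toEmbedding with hΛ'
  have hsub : Λ' ⊆ Λ := centredCube_subset_lagBox (by omega)
  set μ : Measure (LGConfig 4 G) := ymSpecification (d := 4) r.ρ β Λ η with hμ
  haveI : IsProbabilityMeasure μ := isProbabilityMeasure_ymSpecification r.ρ r.continuous β Λ η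
  set F : LGConfig 4 G → ℝ := softLoopObs r R with hF
  have hFc : Continuous F := continuous_softLoopObs r R
  have hFc' : Continuous fun U => F (timeShiftLG (G := G) R U) := hFc.comp (continuous_timeShiftLG R)
  have hqc : Continuous fun U => F U * F (timeShiftLG (G := G) R U) := hFc.mul hFc'
  have hFK : ∀ U, |F U| ≤ B := abs_softLoopObs_le' r R
  have hFK' : ∀ U, |F (timeShiftLG (G := G) R U)| ≤ B := fun U => abs_softLoopObs_le' r R _
  have hqK : ∀ U, |F U * F (timeShiftLG (G := G) R U)| ≤ B ^ 2 := abs_softLoopObs_mul_le r R R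
  -- the inner-kernel means
  set h : LGConfig 4 G → ℝ := fun ζ => ∫ W, F W ∂(ymSpecification (d := 4) r.ρ β Λ' ζ) with hh
  set k : LGConfig 4 G → ℝ := fun ζ => ∫ W, F (timeShiftLG (G := G) R W) ∂(ymSpecification (d := 4) r.ρ β Λ' ζ) with hk
  set q : LGConfig 4 G → ℝ :=
    fun ζ => ∫ W, F W * F (timeShiftLG (G := G) R W) ∂(ymSpecification (d := 4) r.ρ β Λ' ζ) with hq
  have hhm : Measurable h := (continuous_integral_ymSpecification r.ρ r.continuous β Λ' hFc hFK).measurable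
  have hkm : Measurable k := (continuous_integral_ymSpecification r.ρ r.continuous β Λ' hFc' hFK').measurable
  have hqm : Measurable q := (continuous_integral_ymSpecification r.ρ r.continuous β Λ' hqc hqK).measurable
  have hhK : ∀ ζ, |h ζ| ≤ B := fun ζ => abs_integral_ymSpecification_le r.ρ r.continuous β Λ' hFK _
  have hkK : ∀ ζ, |k ζ| ≤ B := fun ζ => abs_integral_ymSpecification_le r.ρ r.continuous β Λ' hFK' _
  have hqK' : ∀ ζ, |q ζ| ≤ B ^ 2 := fun ζ => abs_integral_ymSpecification_le r.ρ r.continuous β Λ' hqK _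
  -- DLR consistency: the outer covariance through the inner kernels
  have hch : ∫ ζ, h ζ ∂μ = ∫ W, F W ∂μ := integral_ymSpecification_consistent r β hsub η hFc.measurable hFK
  have hck : ∫ ζ, k ζ ∂μ = ∫ W, F (timeShiftLG (G := G) R W) ∂μ :=
    integral_ymSpecification_consistent r β hsub η hFc'.measurable hFK'
  have hcq : ∫ ζ, q ζ ∂μ = ∫ W, F W * F (timeShiftLG (G := G) R W) ∂μ :=
    integral_ymSpecification_consistent r β hsub η hqc.measurable hqK
  -- the exceptional set: outer hot ∪ {inner kernel charges the shifted inner hot event by more than `e'`}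
  set cold : Set (LGConfig 4 G) := coldEvent r β κ Λ with hcolddef
  set hot'' : Set (LGConfig 4 G) := {U | configShift bc U ∉ coldEvent r β (2 * κ) Λ₀} with hhot''
  have hcoldm : MeasurableSet cold := measurableSet_coldEvent r β κ Λ
  have hhot''m : MeasurableSet hot'' := measurableSet_innerHot_shift r β κ H
  set g₂ : LGConfig 4 G → ℝ := fun ζ => (ymSpecification (d := 4) r.ρ β Λ' ζ).real hot'' with hg₂
  have hg₂m : Measurable g₂ := (measurable_ymSpecification_apply r.ρ r.continuous β Λ' hhot''m).ennreal_toReal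
  set E : Set (LGConfig 4 G) := coldᶜ ∪ {ζ | e' < g₂ ζ} with hE
  have hEm : MeasurableSet E := hcoldm.compl.union (measurableSet_lt measurable_const hg₂m)
  -- its mass
  have hcold_real : μ.real coldᶜ ≤ eo := by
    rw [measureReal_def]
    exact ENNReal.toReal_le_of_le_ofReal heo0.le hcold
  have hhot''sub : hot'' ⊆ coldᶜ := fun U hU => not_mem_coldEvent_of_innerHot r hb6 hκ.le (by omega) hU
  have hμE : μ.real E ≤ p := by
    have h2 : μ.real {ζ | e' < g₂ ζ} ≤ eo / e' := by
      have hg0 : ∀ ζ, 0 ≤ g₂ ζ := fun ζ => measureReal_nonneg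
      have hg1 : ∀ ζ, |g₂ ζ| ≤ 1 := fun ζ => by
        haveI := isProbabilityMeasure_ymSpecification r.ρ r.continuous β Λ' ζ
        rw [abs_of_nonneg (hg0 ζ)]
        exact measureReal_le_one
      have hgi : Integrable g₂ μ :=
        Integrable.of_bound hg₂m.aestronglyMeasurable 1 (ae_of_all _ fun ζ => by rw [Real.norm_eq_abs]; exact hg1 ζ)
      have hmarkov : e' * μ.real {ζ | e' ≤ g₂ ζ} ≤ ∫ ζ, g₂ ζ ∂μ := mul_meas_ge_le_integral_of_nonneg (ae_of_all _ hg0) hgi e'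
      have hmono : μ.real {ζ | e' < g₂ ζ} ≤ μ.real {ζ | e' ≤ g₂ ζ} := measureReal_mono fun ζ (hζ : e' < g₂ ζ) => hζ.le
      have hint : ∫ ζ, g₂ ζ ∂μ ≤ eo := by
        rw [hg₂, measureReal_ymSpecification_consistent r β hsub η hhot''m]
        exact (measureReal_mono hhot''sub).trans hcold_real
      have hmono' := mul_le_mul_of_nonneg_left hmono he'0.le
      rw [le_div_iff₀ he'0, mul_comm]
      linarith
    calc μ.real E ≤ μ.real coldᶜ + μ.real {ζ | e' < g₂ ζ} := measureReal_union_le _ _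
      _ ≤ eo + eo / e' := add_le_add hcold_real h2
  -- off the exceptional set: (E1), (E2) through the translation bridge
  have inner : ∀ ζ, ζ ∉ E → θ₀ ≤ q ζ - h ζ * k ζ ∧ |k ζ - h ζ| ≤ ε₀ := by
    intro ζ hζ
    have hζc : ζ ∈ cold := by
      by_contra h'
      exact hζ (Set.mem_union_left _ h')
    have hζ2 : g₂ ζ ≤ e' := not_lt.1 fun h' => hζ (Set.mem_union_right _ h')
    have hgood : CrudeGoodG r.ρ β (κ / 2) H (configShift bc ζ) := crudeGoodG_configShift_of_mem_coldEvent r (by omega) hζc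
    haveI := isProbabilityMeasure_ymSpecification r.ρ r.continuous β Λ₀ (configShift bc ζ)
    have htyp : boxKernelG r.ρ β H (configShift bc ζ) (coldEvent r β (2 * κ) (AxialGauge.boxEdges 4 (2 * H + 1)))ᶜ ≤
        ENNReal.ofReal e' := by
      have hreal : (ymSpecification (d := 4) r.ρ β Λ₀ (configShift bc ζ)).real
          (coldEvent r β (2 * κ) (AxialGauge.boxEdges 4 (2 * H + 1)))ᶜ ≤ e' := by
        rw [innerKernel_real_preimage_eq r β Λ₀ bc ζ (measurableSet_coldEvent r β (2 * κ) _).compl]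
        exact hζ2
      show ymSpecification (d := 4) r.ρ β Λ₀ (configShift bc ζ) _ ≤ _
      rw [← ofReal_measureReal (measure_ne_top _ _)]
      exact ENNReal.ofReal_le_ofReal hreal
    have h1 := hE1 β hb1 _ hgood htyp
    have h2 := hE2 β hb2 _ hgood htyp
    -- the translation bridge for the three means
    have hcomm : ∀ W : LGConfig 4 G,
        timeShiftLG (G := G) R (configShift (-bc) W) = configShift (-bc) (timeShiftLG (G := G) R W) := fun W =>
      configShift_comm _ _ W
    have eh : h ζ = ∫ W, F (configShift (-bc) W) ∂(ymSpecification (d := 4) r.ρ β Λ₀ (configShift bc ζ)) :=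
      integral_innerKernel_eq r β Λ₀ bc ζ F
    have ek : k ζ = ∫ W, F (configShift (-bc) (timeShiftLG (G := G) R W)) ∂(ymSpecification (d := 4) r.ρ β Λ₀ (configShift bc ζ)) := by
      have e := integral_innerKernel_eq r β Λ₀ bc ζ (fun W => F (timeShiftLG (G := G) R W))
      simp only [hcomm] at e
      exact e
    have eq' : q ζ = ∫ W, F (configShift (-bc) W) * F (configShift (-bc) (timeShiftLG (G := G) R W))
        ∂(ymSpecification (d := 4) r.ρ β Λ₀ (configShift bc ζ)) := by
      have e := integral_innerKernel_eq r β Λ₀ bc ζ (fun W => F W * F (timeShiftLG (G := G) R W))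
      simp only [hcomm] at e
      exact e
    refine ⟨?_, ?_⟩
    · rw [eq', eh, ek]
      simpa only [lagCov, boxKernelG] using h1
    · rw [ek, eh]
      refine (by simpa only [boxKernelG] using h2 :
        |(∫ W, F (configShift (-bc) (timeShiftLG (G := G) R W)) ∂(ymSpecification (d := 4) r.ρ β Λ₀ (configShift bc ζ))) -
            ∫ W, F (configShift (-bc) W) ∂(ymSpecification (d := 4) r.ρ β Λ₀ (configShift bc ζ))| ≤
          K * (R : ℝ) ^ 8 * β ^ (κ - 1) / (H : ℝ)).trans ?_
      rw [hε₀]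
      have e1 : K * (R : ℝ) ^ 8 * β ^ (κ - 1) / (H : ℝ) = K * ((R : ℝ) ^ 8 * β ^ (κ - 1) / (H : ℝ)) := by ring
      have e2 : |K| * (R : ℝ) ^ 8 * β ^ (κ - 1) / (H : ℝ) = |K| * ((R : ℝ) ^ 8 * β ^ (κ - 1) / (H : ℝ)) := by ring
      rw [e1, e2]
      exact mul_le_mul_of_nonneg_right (le_abs_self K) (by positivity)
  -- the law of total covariance under the outer kernel
  have key := total_covariance_lower_bound_sub (μ := μ) hEm hhm hkm hqm hhK hkK hqK' hθ0 (fun ζ hζ => (inner ζ hζ).1)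
    (fun ζ hζ => (inner ζ hζ).2) hμE
  rw [hch, hck, hcq] at key
  -- removing the conditioning on the outer cold event
  have heo_lt : eo < 1 := by
    rw [heodef]
    exact Real.exp_lt_one_iff.2 (by have := Real.rpow_pos_of_pos hβ0 (κ / 4); linarith)
  have hpc : 1 - eo ≤ μ.real cold := by
    have h := probReal_compl_eq_one_sub (μ := μ) hcoldm
    linarith
  have hA0 : μ cold ≠ 0 := by
    intro h0
    have : μ.real cold = 0 := by rw [measureReal_def, h0, ENNReal.toReal_zero]
    linarith
  have hup : (∫ W, F W * F (timeShiftLG (G := G) R W) ∂μ) - (∫ W, F W ∂μ) * ∫ W, F (timeShiftLG (G := G) R W) ∂μ ≤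
      μ.real cold * ((∫ W, F W * F (timeShiftLG (G := G) R W) ∂(ProbabilityTheory.cond μ cold)) -
        (∫ W, F W ∂(ProbabilityTheory.cond μ cold)) * ∫ W, F (timeShiftLG (G := G) R W) ∂(ProbabilityTheory.cond μ cold)) +
        5 * B ^ 2 * μ.real coldᶜ :=
    cov_sub_measureReal_mul_condCov_le (γ := μ) hcoldm hA0 hFc.measurable hFc'.measurable hFK hFK'
  have hpc1 : μ.real cold ≤ 1 := measureReal_le_one
  have hpc0 : 0 < μ.real cold := by linarith
  obtain ⟨Cν, hCν⟩ : ∃ x : ℝ, x = (∫ W, F W * F (timeShiftLG (G := G) R W) ∂(ProbabilityTheory.cond μ cold)) -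
      (∫ W, F W ∂(ProbabilityTheory.cond μ cold)) * ∫ W, F (timeShiftLG (G := G) R W) ∂(ProbabilityTheory.cond μ cold) := ⟨_, rfl⟩
  rw [← hCν] at hup
  have h5 : 5 * B ^ 2 * μ.real coldᶜ ≤ 5 * B ^ 2 * eo := mul_le_mul_of_nonneg_left hcold_real (by positivity)
  have hε4 : ε₀ ^ 2 / 4 ≤ c / 16 * Y := by linarith only [hJ3, sq_nonneg ε₀]
  have hX : 13 * θ₀ / 16 ≤ μ.real cold * Cν := by linarith only [key, hup, h5, hJ, hε4, hθY]
  have hCν0 : 0 ≤ Cν := (mul_nonneg_iff_of_pos_left hpc0).1 (by linarith only [hX, hθ0])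
  have hfin : θ₀ / 8 ≤ Cν := by
    have h1 : μ.real cold * Cν ≤ 1 * Cν := mul_le_mul_of_nonneg_right hpc1 hCν0
    linarith only [hX, h1, hθ0]
  have e8 : c / 8 * (R : ℝ) ^ 3 * β ^ (-(2 : ℝ)) = θ₀ / 8 := by rw [hθ₀]; ring
  rw [e8, ← hCν]
  exact hfin

end Summit.QuantumFields.YangMills.Theorems.SoftLoopLongLag

end
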